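import Mathlib.Data.Nat.Choose.Lucas
import Mathlib.Algebra.CharP.Lemmas
import Summits.CriticalPhenomena.PercolationContinuityZ3.Theorems.PercNearOneGluingNoHeavyLowerTailAntiBandDetCriterion

/-!
# `NoHeavyLowerTail` (crux stmt-CriticalPhenomena-4575), lane prim-ineq-gen-4 (gen 25): MOD-p NONSINGULARITY of the binomial matrix
# `[C(n−1−#(x∪x'), k)]` — conjecture (N)(n,k), hence the anti-band inequality (AB_{k+1})(n), whenever a prime power `q > k` divides `n − 2k − 1`

Support file (`--supports stmt-CriticalPhenomena-4575`; memo `run/shared/lean/prim/prim-ineq-gen-4/FINDING-MODP-NONSINGULARITY-g25.md` §1).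
No definitions, no `sorry`, standard axioms.

THEOREM (memo §1, Theorem 1).  Let `n = |β| ≥ 2k+1`, `N = n − 2k − 1`, and let `q = p^v` be a prime power with `q ∣ N` and `k < q`.  Then for every family `U` of
finsets of size `≤ k` which is up-closed inside the ball (`x ∈ U`, `x ⊆ y`, `#y ≤ k ⇒ y ∈ U`) the matrix `M_U = [C(n−1−#(x∪x'), k)]_{x,x'∈U}` has
`det M_U ≢ 0 (mod p)`, in particular `det M_U ≠ 0` (`det_binomial_ne_zero_of_primePow_dvd`).
Proof (memo §1.3): with `Z[x,z] = [x ⊆ z]` (unitriangular) and `S = diag (−1)^{k+#z}` one has, entrywise over `ℤ`,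
`(Z S Zᵀ)[x,x'] = [#(x∪x') ≤ k]·C(n−1−#(x∪x'), k−#(x∪x'))` (inclusion–exclusion over the subsets of `(x∪x')ᶜ` of size `≤ k − #(x∪x')`,
`AntiBandCoveringDet.sum_neg_one_pow_powerset_card_le`), and by Lucas' theorem both `C(2k−s+N, k)` and `C(2k−s+N, k−s)` are congruent mod `p` to
`C(2k−s, k) = C(2k−s, k−s)` (`q ∣ N`, `k < q`); so `M_U ≡ Z S Zᵀ (mod p)` and `det M_U ≡ det S = ±1`.
COROLLARY (`antiBand_of_primePow_dvd`): with the determinant criterion of gen 21 (`AntiBandDetCriterion.antiBand_of_det_binomial_ne_zero`), (AB_l) holds on `β`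
for EVERY pair of upper sets whenever some prime power `q > l − 1` divides `|β| − 2l + 1` — e.g. (AB_6) on 18, 19, 20, 22, 24, 25 points, (AB_8) on 23 points, and for every `l`
on all `|β| ≥ 2l + lcm(1,…,l−1)`.
-/

namespace Summit.CriticalPhenomena.PercolationContinuityZ3.Theorems.AntiBandModP

open Finset Matrix Polynomial
open scoped FinsetFamily

/-- **Lucas shift.**  In characteristic `p`: if `q = p^v`, `b < q` and `q ∣ T`, then `C(a+T, b) = C(a, b)` in `ZMod p`.
[Lucas' theorem; here via `(X+1)^{p^v} = X^{p^v} + 1` in `(ZMod p)[X]`] -/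
theorem cast_choose_add_eq_of_pow_dvd {p : ℕ} [hp : Fact p.Prime] {v a b T : ℕ} (hb : b < p ^ v) (hT : p ^ v ∣ T) :
    (((a + T).choose b : ℕ) : ZMod p) = ((a.choose b : ℕ) : ZMod p) := by
  obtain ⟨m, rfl⟩ := hT
  have hfrob : ((X : (ZMod p)[X]) + 1) ^ (p ^ v) = X ^ (p ^ v) + 1 := by
    have h := add_pow_char_pow (X : (ZMod p)[X]) 1 p v
    rw [one_pow] at h
    exact h
  have hdvd : (X : (ZMod p)[X]) ^ (p ^ v) ∣ (X ^ (p ^ v) + 1) ^ m - 1 := by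
    have h := sub_dvd_pow_sub_pow ((X : (ZMod p)[X]) ^ (p ^ v) + 1) 1 m
    rw [one_pow, add_sub_cancel_right] at h
    exact h
  obtain ⟨g, hg⟩ := hdvd
  have hexp : ((X : (ZMod p)[X]) + 1) ^ (a + p ^ v * m) = (X + 1) ^ a + X ^ (p ^ v) * ((X + 1) ^ a * g) := by
    rw [pow_add, pow_mul, hfrob]
    have h2 : ((X : (ZMod p)[X]) ^ (p ^ v) + 1) ^ m = 1 + X ^ (p ^ v) * g := by
      rw [← hg]; ring
    rw [h2]; ring
  have hcoeff := congrArg (fun P : (ZMod p)[X] => P.coeff b) hexp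
  simp only [coeff_add, coeff_X_add_one_pow] at hcoeff
  rw [hcoeff, Polynomial.coeff_X_pow_mul', if_neg (not_le.2 hb), add_zero]

variable {β : Type*} [DecidableEq β] [Fintype β]

omit [Fintype β] in
/-- The zeta matrix `Z[x,z] = [x ⊆ z]` of a family `U` is block-triangular with respect to cardinality with identity diagonal blocks, hence `det Z = 1`.
[elementary; cf. `AntiBandCoveringDet.det_zetaSigned_ne_zero`] -/
theorem det_zeta_eq_one (U : Finset (Finset β)) :
    (Matrix.of fun (x : ↥U) (z : ↥U) => if (x : Finset β) ⊆ z then (1 : ℤ) else 0).det = 1 := by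
  set Z : Matrix ↥U ↥U ℤ := Matrix.of fun (x : ↥U) (z : ↥U) => if (x : Finset β) ⊆ z then (1 : ℤ) else 0 with hZ
  have hbt : Z.BlockTriangular (fun z : ↥U => #(z : Finset β)) := by
    intro x z hlt
    simp only [hZ, of_apply]
    rw [if_neg]
    intro hsub
    exact absurd (Finset.card_le_card hsub) (not_le.2 hlt)
  rw [hbt.det]
  apply Finset.prod_eq_one
  intro a _
  have hblock : Z.toSquareBlock (fun z : ↥U => #(z : Finset β)) a
      = (1 : Matrix {z : ↥U // #(z : Finset β) = a} {z : ↥U // #(z : Finset β) = a} ℤ) := by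
    ext i j
    simp only [Matrix.toSquareBlock_def, Matrix.of_apply, Matrix.one_apply, hZ]
    have hi : #((i : ↥U) : Finset β) = a := i.2
    have hj : #((j : ↥U) : Finset β) = a := j.2
    by_cases hij : i = j
    · subst hij
      simp
    · have hne : ((i : ↥U) : Finset β) ≠ ((j : ↥U) : Finset β) := fun h => hij (Subtype.ext (Subtype.ext h))
      have hns : ¬ ((i : ↥U) : Finset β) ⊆ ((j : ↥U) : Finset β) := fun hsub =>
        hne (Finset.eq_of_subset_of_card_le hsub (by rw [hi, hj]))
      simp [hns, hij]
  rw [hblock, det_one]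

/-- Superset counting with signs: for a finset `w` with `#w ≤ k` and `wᶜ` non-empty,
`∑_{z ⊇ w, #z ≤ k} (−1)^{k + #z} = C(|β| − 1 − #w, k − #w)`. [inclusion–exclusion; `AntiBandCoveringDet.sum_neg_one_pow_powerset_card_le`] -/
theorem sum_supersets_neg_one_pow (k : ℕ) (w : Finset β) (hw : #w ≤ k) (hne : (wᶜ : Finset β).Nonempty) :
    ∑ z ∈ (univ : Finset (Finset β)).filter (fun z => w ⊆ z ∧ #z ≤ k), (-1 : ℤ) ^ (k + #z)
      = ((Fintype.card β - 1 - #w).choose (k - #w) : ℤ) := by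
  have hreindex : ∑ z ∈ (univ : Finset (Finset β)).filter (fun z => w ⊆ z ∧ #z ≤ k), (-1 : ℤ) ^ (k + #z)
      = ∑ u ∈ (wᶜ).powerset.filter (fun u => #u ≤ k - #w), (-1 : ℤ) ^ (k + #w) * (-1 : ℤ) ^ #u := by
    refine Finset.sum_bij' (fun z _ => z \ w) (fun u _ => u ∪ w) ?_ ?_ ?_ ?_ ?_
    · intro z hz
      rw [mem_filter] at hz
      rw [mem_filter, mem_powerset]
      refine ⟨?_, ?_⟩
      · intro a ha
        rw [mem_sdiff] at ha
        exact mem_compl.2 ha.2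
      · have := Finset.card_sdiff_add_card_eq_card hz.2.1
        omega
    · intro u hu
      rw [mem_filter, mem_powerset] at hu
      rw [mem_filter]
      refine ⟨mem_univ _, subset_union_right, ?_⟩
      have hdisj : Disjoint u w := by
        rw [← Finset.subset_compl_iff_disjoint_right]
        exact hu.1
      rw [Finset.card_union_of_disjoint hdisj]
      omega
    · intro z hz
      rw [mem_filter] at hz
      exact Finset.sdiff_union_of_subset hz.2.1
    · intro u hu
      rw [mem_filter, mem_powerset] at hu
      have hdisj : Disjoint u w := by
        rw [← Finset.subset_compl_iff_disjoint_right]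
        exact hu.1
      exact Finset.union_sdiff_cancel_right hdisj
    · intro z hz
      rw [mem_filter] at hz
      have := Finset.card_sdiff_add_card_eq_card hz.2.1
      rw [← pow_add]
      congr 1
      omega
  rw [hreindex, ← Finset.mul_sum,
    AntiBandCoveringDet.sum_neg_one_pow_powerset_card_le (wᶜ) (k - #w) hne, Finset.card_compl,
    ← mul_assoc, ← pow_add]
  have heven : Even (k + #w + (k - #w)) := ⟨k, by omega⟩
  rw [heven.neg_one_pow, one_mul]
  congr 2
  omega

/-- **Theorem 1 (mod-`p` nonsingularity).**  `|β| ≥ 2k+1`, `q = p^v` a prime power with `k < q` and `q ∣ |β| − (2k+1)`, `U` a family of finsets of size `≤ k` that is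
up-closed inside the ball.  Then `det [C(|β|−1−#(x∪x'), k)]_{x,x'∈U} ≠ 0` — indeed `≡ ±1 (mod p)`.  [memo FINDING-MODP-NONSINGULARITY-g25.md §1] -/
theorem det_binomial_ne_zero_of_primePow_dvd (k : ℕ) (U : Finset (Finset β))
    (hUk : ∀ x ∈ U, #x ≤ k) (hUup : ∀ x ∈ U, ∀ y : Finset β, x ⊆ y → #y ≤ k → y ∈ U)
    {p : ℕ} [hp : Fact p.Prime] (v : ℕ) (hkq : k < p ^ v) (hβ : 2 * k + 1 ≤ Fintype.card β)
    (hdvd : p ^ v ∣ Fintype.card β - (2 * k + 1)) :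
    (Matrix.of fun (x x' : ↥U) => ((Fintype.card β - 1 - #((x : Finset β) ∪ x')).choose k : ℤ)).det ≠ 0 := by
  set n : ℕ := Fintype.card β with hn
  set N : ℕ := n - (2 * k + 1) with hN
  set M : Matrix ↥U ↥U ℤ := Matrix.of fun (x x' : ↥U) => ((n - 1 - #((x : Finset β) ∪ x')).choose k : ℤ) with hM
  set Z : Matrix ↥U ↥U ℤ := Matrix.of fun (x : ↥U) (z : ↥U) => if (x : Finset β) ⊆ z then (1 : ℤ) else 0 with hZ
  set Sd : Matrix ↥U ↥U ℤ := Matrix.diagonal fun (z : ↥U) => (-1 : ℤ) ^ (k + #(z : Finset β)) with hSd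
  -- (1) the entries of `Z Sd Zᵀ`
  have hentry : ∀ x x' : ↥U, (Z * Sd * Zᵀ) x x'
      = if #((x : Finset β) ∪ x') ≤ k then (((n - 1 - #((x : Finset β) ∪ x')).choose (k - #((x : Finset β) ∪ x')) : ℕ) : ℤ) else 0 := by
    intro x x'
    rw [Matrix.mul_apply]
    simp only [Matrix.mul_diagonal, transpose_apply, of_apply, hZ, hSd]
    set w : Finset β := (x : Finset β) ∪ x' with hw
    calc ∑ z : ↥U, ((if (x : Finset β) ⊆ z then (1 : ℤ) else 0) * (-1 : ℤ) ^ (k + #(z : Finset β)) *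
              (if (x' : Finset β) ⊆ z then (1 : ℤ) else 0))
        = ∑ z ∈ U, ((if (x : Finset β) ⊆ z then (1 : ℤ) else 0) * (-1 : ℤ) ^ (k + #z) *
              (if (x' : Finset β) ⊆ z then (1 : ℤ) else 0)) := by
          rw [univ_eq_attach]
          exact Finset.sum_attach U (fun z => (if (x : Finset β) ⊆ z then (1 : ℤ) else 0) * (-1 : ℤ) ^ (k + #z) *
              (if (x' : Finset β) ⊆ z then (1 : ℤ) else 0))
      _ = ∑ z ∈ U, (if w ⊆ z then (-1 : ℤ) ^ (k + #z) else 0) := by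
          apply Finset.sum_congr rfl
          intro z _
          by_cases h1 : (x : Finset β) ⊆ z <;> by_cases h2 : (x' : Finset β) ⊆ z
          · have h3 : w ⊆ z := Finset.union_subset h1 h2
            simp [h1, h2, h3]
          · have h3 : ¬ w ⊆ z := fun h => h2 (subset_union_right.trans h)
            simp [h1, h2, h3]
          · have h3 : ¬ w ⊆ z := fun h => h1 (subset_union_left.trans h)
            simp [h1, h2, h3]
          · have h3 : ¬ w ⊆ z := fun h => h1 (subset_union_left.trans h)
            simp [h1, h2, h3]
      _ = ∑ z ∈ U.filter (fun z => w ⊆ z), (-1 : ℤ) ^ (k + #z) := (Finset.sum_filter _ _).symm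
      _ = if #w ≤ k then (((n - 1 - #w).choose (k - #w) : ℕ) : ℤ) else 0 := by
          by_cases hwk : #w ≤ k
          · rw [if_pos hwk]
            have hwU : w ∈ U := hUup x x.2 w subset_union_left hwk
            have hfilt : U.filter (fun z => w ⊆ z) = (univ : Finset (Finset β)).filter (fun z => w ⊆ z ∧ #z ≤ k) := by
              ext z
              simp only [mem_filter, mem_univ, true_and]
              constructor
              · exact fun h => ⟨h.2, hUk z h.1⟩
              · exact fun h => ⟨hUup w hwU z h.1 h.2, h.1⟩
            have hne : (wᶜ : Finset β).Nonempty := by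
              rw [← Finset.card_pos, Finset.card_compl]
              have : #w ≤ 2 * k := by omega
              omega
            rw [hfilt, sum_supersets_neg_one_pow k w hwk hne]
          · rw [if_neg hwk]
            apply Finset.sum_eq_zero
            intro z hz
            rw [mem_filter] at hz
            exact absurd ((Finset.card_le_card hz.2).trans (hUk z hz.1)) hwk
  -- (2) the entrywise congruence `M ≡ Z Sd Zᵀ (mod p)`
  have hcong : M.map (Int.castRingHom (ZMod p)) = (Z * Sd * Zᵀ).map (Int.castRingHom (ZMod p)) := by
    ext x x'
    rw [Matrix.map_apply, Matrix.map_apply, hentry x x']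
    simp only [hM, of_apply, eq_intCast, Int.cast_natCast]
    set s : ℕ := #((x : Finset β) ∪ x') with hs
    have hs2k : s ≤ 2 * k := (Finset.card_union_le _ _).trans (by have := hUk x x.2; have := hUk x' x'.2; omega)
    have hNdvd : p ^ v ∣ N := hdvd
    have hrew : n - 1 - s = (2 * k - s) + N := by omega
    rw [hrew, cast_choose_add_eq_of_pow_dvd hkq hNdvd]
    by_cases hsk : s ≤ k
    · rw [if_pos hsk, Int.cast_natCast, cast_choose_add_eq_of_pow_dvd (lt_of_le_of_lt (Nat.sub_le k s) hkq) hNdvd]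
      have : (2 * k - s).choose k = (2 * k - s).choose (k - s) := by
        have h := @Nat.choose_symm_add (k - s) k
        have e : k - s + k = 2 * k - s := by omega
        rw [e] at h
        exact h.symm
      rw [this]
    · rw [if_neg hsk, Int.cast_zero, Nat.choose_eq_zero_of_lt (by omega), Nat.cast_zero]
  -- (3) determinants
  have hdetZ : Z.det = 1 := det_zeta_eq_one U
  have hdetS2 : (Z * Sd * Zᵀ).det ^ 2 = 1 := by
    rw [det_mul, det_mul, det_transpose, hdetZ, one_mul, mul_one, hSd, det_diagonal, ← Finset.prod_pow]
    apply Finset.prod_eq_one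
    intro z _
    rw [← pow_mul]
    exact Even.neg_one_pow ⟨k + #(z : Finset β), by ring⟩
  have hcast : (Int.castRingHom (ZMod p)) M.det = (Int.castRingHom (ZMod p)) (Z * Sd * Zᵀ).det := by
    rw [RingHom.map_det, RingHom.map_det, RingHom.mapMatrix_apply, RingHom.mapMatrix_apply, hcong]
  intro hzero
  have h1 : ((Int.castRingHom (ZMod p)) (Z * Sd * Zᵀ).det) ^ 2 = 1 := by
    rw [← map_pow, hdetS2, map_one]
  rw [← hcast] at h1
  have hMeq : M.det = 0 := hzero
  rw [hMeq, map_zero, zero_pow two_ne_zero] at h1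
  haveI : Fact (1 < p) := ⟨hp.out.one_lt⟩
  exact zero_ne_one h1

/-- **Corollary ((AB_l) at the mod-`p` cells).**  If `1 ≤ l`, `2l ≤ |β|` and some prime power `q = p^v > l − 1` divides `|β| − (2l − 1)`, then for ALL upper sets `A, V` of
finsets of `β`:  `#{s ∈ A ∩ Vᶜˢ | #s < l ∨ #sᶜ < l} ≤ #{s ∈ A ∩ V | #s < l ∨ #sᶜ < l}`  (the anti-band inequality (AB_l)).
[Theorem 1 + the determinant criterion `AntiBandDetCriterion.antiBand_of_det_binomial_ne_zero` (gen 21)] -/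
theorem antiBand_of_primePow_dvd (l : ℕ) (hl : 1 ≤ l) (A V : Finset (Finset β))
    (hA : IsUpperSet (A : Set (Finset β))) (hV : IsUpperSet (V : Set (Finset β))) (hβ : 2 * l ≤ Fintype.card β)
    {p : ℕ} [hp : Fact p.Prime] (v : ℕ) (hlq : l - 1 < p ^ v) (hdvd : p ^ v ∣ Fintype.card β - (2 * l - 1)) :
    #((A ∩ Vᶜˢ).filter fun s => #s < l ∨ #sᶜ < l) ≤ #((A ∩ V).filter fun s => #s < l ∨ #sᶜ < l) := by
  apply AntiBandDetCriterion.antiBand_of_det_binomial_ne_zero l hl A V hA hV hβ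
  have h2 : 2 * (l - 1) + 1 = 2 * l - 1 := by omega
  refine det_binomial_ne_zero_of_primePow_dvd (l - 1) (A.filter fun s => #s < l) ?_ ?_ v hlq (by omega) (by rw [h2]; exact hdvd)
  · intro x hx
    rw [mem_filter] at hx
    omega
  · intro x hx y hxy hy
    rw [mem_filter] at hx ⊢
    exact ⟨Finset.mem_coe.1 (hA hxy (Finset.mem_coe.2 hx.1)), by omega⟩


/-- **Number-theoretic glue.**  If `N ≠ 0` does not divide `lcm(1,…,k)`, then some prime power `q = p^v` with `q ∣ N` exceeds `k`
(otherwise every `p^{v_p(N)}` lies in `[1,k]`, divides the lcm, and `N ∣ lcm` by comparing factorizations). [elementary] -/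
theorem exists_primePow_dvd_of_not_dvd_lcm {N k : ℕ} (hN : N ≠ 0) (h : ¬ N ∣ (Finset.Icc 1 k).lcm id) :
    ∃ p v : ℕ, p.Prime ∧ p ^ v ∣ N ∧ k < p ^ v := by
  by_contra H
  push Not at H
  apply h
  have hL : (Finset.Icc 1 k).lcm id ≠ 0 := by
    rw [Ne, Finset.lcm_eq_zero_iff]
    rintro ⟨x, hx, hx0⟩
    rw [Finset.mem_Icc] at hx
    simp only [id] at hx0
    omega
  rw [← Nat.factorization_le_iff_dvd hN hL, Finsupp.le_iff]
  intro p hp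
  have hpp : p.Prime := Nat.prime_of_mem_primeFactors (by simpa using hp)
  have hq : p ^ N.factorization p ∣ N := Nat.ordProj_dvd N p
  have hqk : p ^ N.factorization p ≤ k := H p (N.factorization p) hpp hq
  have hq1 : 1 ≤ p ^ N.factorization p := Nat.one_le_pow _ _ hpp.pos
  have hmem : p ^ N.factorization p ∈ Finset.Icc 1 k := Finset.mem_Icc.2 ⟨hq1, hqk⟩
  have hdl : p ^ N.factorization p ∣ (Finset.Icc 1 k).lcm id := Finset.dvd_lcm hmem
  exact (hpp.pow_dvd_iff_le_factorization hL).1 hdl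

/-- **Corollary ((AB_l) off the divisor cells).**  `1 ≤ l`, `2l ≤ |β|`, and `|β| − (2l−1)` does NOT divide `lcm(1,…,l−1)` ⇒ (AB_l) for all upper sets `A, V` on `β`.
So for each `l` the only possibly-open ground-set sizes are `|β| = 2l−1+N` with `N ∣ lcm(1,…,l−1)` — finitely many. [Theorem 1 + glue] -/
theorem antiBand_of_not_dvd_lcm (l : ℕ) (hl : 1 ≤ l) (A V : Finset (Finset β))
    (hA : IsUpperSet (A : Set (Finset β))) (hV : IsUpperSet (V : Set (Finset β))) (hβ : 2 * l ≤ Fintype.card β)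
    (hN : ¬ (Fintype.card β - (2 * l - 1)) ∣ (Finset.Icc 1 (l - 1)).lcm id) :
    #((A ∩ Vᶜˢ).filter fun s => #s < l ∨ #sᶜ < l) ≤ #((A ∩ V).filter fun s => #s < l ∨ #sᶜ < l) := by
  obtain ⟨p, v, hp, hdvd, hlt⟩ := exists_primePow_dvd_of_not_dvd_lcm (N := Fintype.card β - (2 * l - 1)) (by omega) hN
  haveI : Fact p.Prime := ⟨hp⟩
  exact antiBand_of_primePow_dvd l hl A V hA hV hβ v hlt hdvd

/-- **Corollary ((AB_l) for every large ground set).**  `1 ≤ l` and `|β| ≥ 2l + lcm(1,…,l−1)` ⇒ (AB_l) holds for all upper sets `A, V` on `β`: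
for EVERY `l`, the anti-band inequality (AB_l)(y) holds for all but finitely many `y`. [Theorem 1 + glue] -/
theorem antiBand_of_lcm_le_card (l : ℕ) (hl : 1 ≤ l) (A V : Finset (Finset β))
    (hA : IsUpperSet (A : Set (Finset β))) (hV : IsUpperSet (V : Set (Finset β)))
    (hβ : 2 * l + (Finset.Icc 1 (l - 1)).lcm id ≤ Fintype.card β) :
    #((A ∩ Vᶜˢ).filter fun s => #s < l ∨ #sᶜ < l) ≤ #((A ∩ V).filter fun s => #s < l ∨ #sᶜ < l) := by
  apply antiBand_of_not_dvd_lcm l hl A V hA hV (by omega)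
  intro hd
  have hpos : 0 < Fintype.card β - (2 * l - 1) := by omega
  have hL : (Finset.Icc 1 (l - 1)).lcm id ≠ 0 := by
    rw [Ne, Finset.lcm_eq_zero_iff]
    rintro ⟨x, hx, hx0⟩
    rw [Finset.mem_Icc] at hx
    simp only [id] at hx0
    omega
  have hle := Nat.le_of_dvd (Nat.pos_of_ne_zero hL) hd
  omega


/-- **Theorem 1′ (the 3-parameter family (M′_gen) of g23 §3, mod-`p` nonsingularity).**  `r ≤ k`, `k+r+1 ≤ |β|`, `q = p^v > k` a prime power dividing `|β| − (k+r+1)`,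
`U` a family of finsets of size `≤ r` up-closed inside `ball_r`.  Then `det [C(|β|−1−#(x∪x'), k)]_{x,x'∈U} ≠ 0` (indeed `≡ ±1 (mod p)`); `r = k` is Theorem 1, and
`|β| = k+r+1` (no arithmetic hypothesis: `q ∣ 0`) is the boundary case of (M′_gen).  [memo FINDING-MODP-NONSINGULARITY-g25.md §1.9; same proof with the corner `C(k+r−s, k)`] -/
theorem det_binomial_ne_zero_of_primePow_dvd_gen (k r : ℕ) (hrk : r ≤ k) (U : Finset (Finset β))
    (hUr : ∀ x ∈ U, #x ≤ r) (hUup : ∀ x ∈ U, ∀ y : Finset β, x ⊆ y → #y ≤ r → y ∈ U)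
    {p : ℕ} [hp : Fact p.Prime] (v : ℕ) (hkq : k < p ^ v) (hβ : k + r + 1 ≤ Fintype.card β)
    (hdvd : p ^ v ∣ Fintype.card β - (k + r + 1)) :
    (Matrix.of fun (x x' : ↥U) => ((Fintype.card β - 1 - #((x : Finset β) ∪ x')).choose k : ℤ)).det ≠ 0 := by
  set n : ℕ := Fintype.card β with hn
  set N : ℕ := n - (k + r + 1) with hN
  set M : Matrix ↥U ↥U ℤ := Matrix.of fun (x x' : ↥U) => ((n - 1 - #((x : Finset β) ∪ x')).choose k : ℤ) with hM
  set Z : Matrix ↥U ↥U ℤ := Matrix.of fun (x : ↥U) (z : ↥U) => if (x : Finset β) ⊆ z then (1 : ℤ) else 0 with hZ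
  set Sd : Matrix ↥U ↥U ℤ := Matrix.diagonal fun (z : ↥U) => (-1 : ℤ) ^ (r + #(z : Finset β)) with hSd
  have hentry : ∀ x x' : ↥U, (Z * Sd * Zᵀ) x x'
      = if #((x : Finset β) ∪ x') ≤ r then (((n - 1 - #((x : Finset β) ∪ x')).choose (r - #((x : Finset β) ∪ x')) : ℕ) : ℤ) else 0 := by
    intro x x'
    rw [Matrix.mul_apply]
    simp only [Matrix.mul_diagonal, transpose_apply, of_apply, hZ, hSd]
    set w : Finset β := (x : Finset β) ∪ x' with hw
    calc ∑ z : ↥U, ((if (x : Finset β) ⊆ z then (1 : ℤ) else 0) * (-1 : ℤ) ^ (r + #(z : Finset β)) *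
              (if (x' : Finset β) ⊆ z then (1 : ℤ) else 0))
        = ∑ z ∈ U, ((if (x : Finset β) ⊆ z then (1 : ℤ) else 0) * (-1 : ℤ) ^ (r + #z) *
              (if (x' : Finset β) ⊆ z then (1 : ℤ) else 0)) := by
          rw [univ_eq_attach]
          exact Finset.sum_attach U (fun z => (if (x : Finset β) ⊆ z then (1 : ℤ) else 0) * (-1 : ℤ) ^ (r + #z) *
              (if (x' : Finset β) ⊆ z then (1 : ℤ) else 0))
      _ = ∑ z ∈ U, (if w ⊆ z then (-1 : ℤ) ^ (r + #z) else 0) := by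
          apply Finset.sum_congr rfl
          intro z _
          by_cases h1 : (x : Finset β) ⊆ z <;> by_cases h2 : (x' : Finset β) ⊆ z
          · have h3 : w ⊆ z := Finset.union_subset h1 h2
            simp [h1, h2, h3]
          · have h3 : ¬ w ⊆ z := fun h => h2 (subset_union_right.trans h)
            simp [h1, h2, h3]
          · have h3 : ¬ w ⊆ z := fun h => h1 (subset_union_left.trans h)
            simp [h1, h2, h3]
          · have h3 : ¬ w ⊆ z := fun h => h1 (subset_union_left.trans h)
            simp [h1, h2, h3]
      _ = ∑ z ∈ U.filter (fun z => w ⊆ z), (-1 : ℤ) ^ (r + #z) := (Finset.sum_filter _ _).symm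
      _ = if #w ≤ r then (((n - 1 - #w).choose (r - #w) : ℕ) : ℤ) else 0 := by
          by_cases hwr : #w ≤ r
          · rw [if_pos hwr]
            have hwU : w ∈ U := hUup x x.2 w subset_union_left hwr
            have hfilt : U.filter (fun z => w ⊆ z) = (univ : Finset (Finset β)).filter (fun z => w ⊆ z ∧ #z ≤ r) := by
              ext z
              simp only [mem_filter, mem_univ, true_and]
              constructor
              · exact fun h => ⟨h.2, hUr z h.1⟩
              · exact fun h => ⟨hUup w hwU z h.1 h.2, h.1⟩
            have hne : (wᶜ : Finset β).Nonempty := by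
              rw [← Finset.card_pos, Finset.card_compl]
              omega
            rw [hfilt, sum_supersets_neg_one_pow r w hwr hne]
          · rw [if_neg hwr]
            apply Finset.sum_eq_zero
            intro z hz
            rw [mem_filter] at hz
            exact absurd ((Finset.card_le_card hz.2).trans (hUr z hz.1)) hwr
  have hcong : M.map (Int.castRingHom (ZMod p)) = (Z * Sd * Zᵀ).map (Int.castRingHom (ZMod p)) := by
    ext x x'
    rw [Matrix.map_apply, Matrix.map_apply, hentry x x']
    simp only [hM, of_apply, eq_intCast, Int.cast_natCast]
    set s : ℕ := #((x : Finset β) ∪ x') with hs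
    have hs2r : s ≤ 2 * r := (Finset.card_union_le _ _).trans (by have := hUr x x.2; have := hUr x' x'.2; omega)
    have hNdvd : p ^ v ∣ N := hdvd
    have hrew : n - 1 - s = (k + r - s) + N := by omega
    rw [hrew, cast_choose_add_eq_of_pow_dvd hkq hNdvd]
    by_cases hsr : s ≤ r
    · rw [if_pos hsr, Int.cast_natCast, cast_choose_add_eq_of_pow_dvd (lt_of_le_of_lt (by omega : r - s ≤ k) hkq) hNdvd]
      have : (k + r - s).choose k = (k + r - s).choose (r - s) := by
        have h := @Nat.choose_symm_add (r - s) k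
        have e : r - s + k = k + r - s := by omega
        rw [e] at h
        exact h.symm
      rw [this]
    · rw [if_neg hsr, Int.cast_zero, Nat.choose_eq_zero_of_lt (by omega), Nat.cast_zero]
  have hdetZ : Z.det = 1 := det_zeta_eq_one U
  have hdetS2 : (Z * Sd * Zᵀ).det ^ 2 = 1 := by
    rw [det_mul, det_mul, det_transpose, hdetZ, one_mul, mul_one, hSd, det_diagonal, ← Finset.prod_pow]
    apply Finset.prod_eq_one
    intro z _
    rw [← pow_mul]
    exact Even.neg_one_pow ⟨r + #(z : Finset β), by ring⟩
  have hcast : (Int.castRingHom (ZMod p)) M.det = (Int.castRingHom (ZMod p)) (Z * Sd * Zᵀ).det := by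
    rw [RingHom.map_det, RingHom.map_det, RingHom.mapMatrix_apply, RingHom.mapMatrix_apply, hcong]
  intro hzero
  have h1 : ((Int.castRingHom (ZMod p)) (Z * Sd * Zᵀ).det) ^ 2 = 1 := by
    rw [← map_pow, hdetS2, map_one]
  rw [← hcast] at h1
  have hMeq : M.det = 0 := hzero
  rw [hMeq, map_zero, zero_pow two_ne_zero] at h1
  haveI : Fact (1 < p) := ⟨hp.out.one_lt⟩
  exact zero_ne_one h1

end Summit.CriticalPhenomena.PercolationContinuityZ3.Theorems.AntiBandModP
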